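import Literature.MathematicalPhysics.QuantumLattice.SparseKrausPerturbedState
import HarnessLib

/-!
# Translation covariance of the sparse Kraus perturbation; the cell-averaged translation-invariant state

Topic `Literature/MathematicalPhysics/QuantumLattice`; namespace
`Literature.MathematicalPhysics.QuantumLattice` (the file path). Continuation of
`SparseKrausPerturbedState.lean` (`KrausPattern`, `sparseState`). Everything is a definition with a body
or a PROVED theorem; no named fact.

* `KrausPattern.shift_sparseState` — **covariance**: for a translation-invariant (even) state `ω`,
  translating the sparse perturbation by `v` moves the sublattice of perturbed translates:
  `(sparseState r ω) ∘ τ_v = sparseState (r - v̄) ω`, `v̄ = v mod a`.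
* `InfVolFermionState.avgState` — the uniform average of a finite family of states (a state; affine
  expectations, `shift_avgState`, `meanEnergy_avgState`).
* `KrausPattern.cellState` — the average of `sparseState r ω` over ALL residue classes `r ∈ (ℤ/aℤ)^d`, and
  `KrausPattern.cellState_isTranslationInvariant`: it is translation invariant (the translation-invariant
  comparison state of the variational argument, Ruelle 1969 Thm. 2 / Bratteli–Kishimoto–Robinson 1978 Thm. 2,
  here obtained by perturbing `ω` along every `a`-sparse sublattice and averaging).

## References

* [BratteliKishimotoRobinson1978] Commun. Math. Phys. 64 (1978) 41–48, Thm. 2 and proof of Thm. 1.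
* [Ruelle1969GroundState] D. Ruelle, Commun. Math. Phys. 11 (1969) 339–345, §2 and Thm. 2.
* [BratteliRobinsonI1987] OAQSM 1, §4.3.1 (invariant states, averaging).
-/

noncomputable section

namespace Literature.MathematicalPhysics.QuantumLattice

open Matrix Finset HubbardWave0 Literature.Probability.LatticeModels
open scoped ComplexOrder

variable {d : ℕ}

/-! ### §0. A reindexed intertwining lemma for commuting products -/

section NoncommProd

variable {α α' : Type*} {M M' : Type*} [AddCommMonoid M] [Module ℂ M] [AddCommMonoid M'] [Module ℂ M']

/-- **Intertwining a commuting product along a reindexing**: if `L (f x X) = g (e x) (L X)` for `x ∈ s`,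
then `L (∏_{x∈s} f x X) = ∏_{y ∈ e(s)} g y (L X)`. [folklore] -/
private theorem apply_noncommProd_apply_map (L : M → M') (s : Finset α) (e : α ↪ α')
    (f : α → Module.End ℂ M) (g : α' → Module.End ℂ M') (hf) (hg)
    (h : ∀ x ∈ s, ∀ X, L (f x X) = g (e x) (L X)) (X : M) :
    L (s.noncommProd f hf X) = (s.map e).noncommProd g hg (L X) := by
  induction s using Finset.cons_induction_on generalizing X with
  | empty =>
    simp only [Finset.map_empty]
    rw [Finset.noncommProd_empty, Finset.noncommProd_empty, Module.End.one_apply, Module.End.one_apply]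
  | cons a s ha IH =>
    have hmap : (Finset.cons a s ha).map e = Finset.cons (e a) (s.map e) (by simpa using ha) :=
      Finset.map_cons e a s ha
    rw [Finset.noncommProd_cons, Finset.noncommProd_congr hmap (fun _ _ => rfl), Finset.noncommProd_cons,
      Module.End.mul_apply, Module.End.mul_apply, h a (Finset.mem_cons_self a s),
      IH _ _ (fun x hx => h x (Finset.mem_cons_of_mem hx))]

end NoncommProd

/-! ### §1. The uniform average of finitely many states -/

namespace InfVolFermionState

variable {β : Type*} [Fintype β] [Nonempty β]

/-- **The uniform average** `|β|⁻¹ Σ_b ω_b` of a finite nonempty family of infinite-volume states (the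
state space is convex, Bratteli–Robinson I §2.3.2 / §4.3.1). [cite: BratteliRobinsonI1987, §4.3.1] -/
def avgState (f : β → InfVolFermionState d) : InfVolFermionState d where
  expect Λ := ((Fintype.card β : ℂ)⁻¹) • ∑ b, (f b).expect Λ
  expect_one Λ := by
    have hc : (Fintype.card β : ℂ) ≠ 0 := Nat.cast_ne_zero.2 Fintype.card_ne_zero
    simp only [LinearMap.smul_apply, LinearMap.coe_sum, Finset.sum_apply, expect_one, sum_const,
      Finset.card_univ, nsmul_eq_mul, mul_one, smul_eq_mul]
    exact inv_mul_cancel₀ hc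
  expect_nonneg Λ A := by
    simp only [LinearMap.smul_apply, LinearMap.coe_sum, Finset.sum_apply, smul_eq_mul]
    refine mul_nonneg ?_ (sum_nonneg fun b _ => (f b).expect_nonneg Λ A)
    rw [← Complex.ofReal_natCast, ← Complex.ofReal_inv]
    exact Complex.zero_le_real.2 (inv_nonneg.2 (Nat.cast_nonneg _))
  compatible Λ Λ' h A := by
    simp only [LinearMap.smul_apply, LinearMap.coe_sum, Finset.sum_apply, (f _).compatible h]

/-- The local expectations of the average (definitional). [cite: BratteliRobinsonI1987, §4.3.1] -/
theorem avgState_expect (f : β → InfVolFermionState d) (Λ : Finset (Site d)) (A : FermionOp Λ) :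
    (avgState f).expect Λ A = ((Fintype.card β : ℂ)⁻¹) * ∑ b, (f b).expect Λ A := by
  simp only [avgState, LinearMap.smul_apply, LinearMap.coe_sum, Finset.sum_apply, smul_eq_mul]

/-- Translating the average translates every member. [cite: BratteliRobinsonI1987, §4.3.1] -/
theorem shift_avgState (f : β → InfVolFermionState d) (v : Site d) :
    (avgState f).shift v = avgState fun b => (f b).shift v :=
  InfVolFermionState.ext fun Λ => LinearMap.ext fun A => by
    rw [shift_expect, avgState_expect, avgState_expect]
    rfl

/-- The average is invariant under reindexing the family by a bijection. [cite: BratteliRobinsonI1987, §4.3.1] -/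
theorem avgState_comp_equiv (f : β → InfVolFermionState d) (e : β ≃ β) :
    avgState (f ∘ e) = avgState f :=
  InfVolFermionState.ext fun Λ => LinearMap.ext fun A => by
    rw [avgState_expect, avgState_expect]
    exact congrArg _ (e.sum_comp (fun b => (f b).expect Λ A))

/-- An average of even states is even. [cite: ArakiMoriya2003, §4.1 Def. 4.5] -/
theorem isEven_avgState {f : β → InfVolFermionState d} (hf : ∀ b, (f b).IsEven) : (avgState f).IsEven := by
  intro Λ A
  rw [avgState_expect, avgState_expect]
  exact congrArg _ (Finset.sum_congr rfl fun b _ => hf b Λ A)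

/-- **The mean energy is affine**: `e_Φ(|β|⁻¹ Σ_b ω_b) = |β|⁻¹ Σ_b e_Φ(ω_b)`.
[cite: BratteliKishimotoRobinson1978, §3 (the mean energy functional is affine)] -/
theorem meanEnergy_avgState (Ψ : FermionInteraction d) (R : ℝ) (f : β → InfVolFermionState d) :
    (avgState f).meanEnergy Ψ R = (Fintype.card β : ℝ)⁻¹ * ∑ b, (f b).meanEnergy Ψ R := by
  simp only [meanEnergy, avgState_expect]
  rw [← Complex.ofReal_natCast, ← Complex.ofReal_inv, Complex.re_ofReal_mul, Complex.re_sum]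

end InfVolFermionState

/-! ### §2. Translation covariance of the sparse perturbation -/

namespace KrausPattern

variable (P : KrausPattern d)

/-- The residue class `v mod a ∈ (ℤ/aℤ)^d` of a lattice vector. [cite: Ruelle1969GroundState, §2 (lattice translations)] -/
def residue (v : Site d) : Fin d → ZMod P.a := fun i => ((v i : ℤ) : ZMod P.a)

/-- `x - v ≡ r - v̄` iff `x ≡ r` (mod `a`). [cite: Ruelle1969GroundState, §2 (lattice translations)] -/
theorem isSparse_sub_iff {r : Fin d → ZMod P.a} {v x : Site d} :
    P.IsSparse (r - P.residue v) (x - v) ↔ P.IsSparse r x := by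
  refine forall_congr' fun i => ?_
  rw [Pi.sub_apply, Pi.sub_apply, Int.cast_sub, residue, sub_left_inj]

/-- The translates meeting `Λ + v` are the `v`-translates of those (of the shifted class) meeting `Λ`.
[cite: BratteliRobinsonII1997, §6.2.1 (covariance of the local structure)] -/
theorem mem_touch_shiftSet {r : Fin d → ZMod P.a} {v : Site d} {Λ : Finset (Site d)} {x : Site d} :
    x ∈ P.touch r (shiftSet v Λ) ↔ x - v ∈ P.touch (r - P.residue v) Λ := by
  rw [mem_touch, mem_touch, isSparse_sub_iff]
  refine and_congr_right fun _ => exists_congr fun y => and_congr_right fun _ => ?_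
  rw [mem_shiftSet, add_sub_assoc]

/-- `touch r (Λ + v) = touch (r - v̄) Λ + v`. [cite: BratteliRobinsonII1997, §6.2.1 (covariance of the local structure)] -/
theorem touch_shiftSet (r : Fin d → ZMod P.a) (v : Site d) (Λ : Finset (Site d)) :
    P.touch r (shiftSet v Λ) = shiftSet v (P.touch (r - P.residue v) Λ) := by
  ext x
  rw [mem_touch_shiftSet, mem_shiftSet]

/-- `hull r (Λ + v) = hull (r - v̄) Λ + v`. [cite: BratteliRobinsonII1997, §6.2.1 (covariance of the local structure)] -/
theorem hull_shiftSet (r : Fin d → ZMod P.a) (v : Site d) (Λ : Finset (Site d)) :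
    P.hull r (shiftSet v Λ) = shiftSet v (P.hull (r - P.residue v) Λ) := by
  ext z
  simp only [hull, Finset.mem_union, Finset.mem_biUnion, mem_shiftSet, mem_touch_shiftSet]
  refine or_congr Iff.rfl ⟨?_, ?_⟩
  · rintro ⟨x, hx, hz⟩
    exact ⟨x - v, hx, by rwa [sub_sub_sub_cancel_right]⟩
  · rintro ⟨x', hx', hz⟩
    refine ⟨x' + v, by rwa [add_sub_cancel_right], ?_⟩
    rw [← sub_sub, sub_right_comm]
    exact hz

/-- The translation of the hull of `Λ` (for the shifted class) onto the hull of `Λ + v`, as an injection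
of sites. [cite: BratteliRobinsonII1997, §6.2.1 (covariance of the local structure)] -/
def hullShiftEmb (r : Fin d → ZMod P.a) (v : Site d) (Λ : Finset (Site d)) :
    PolySite (P.hull (r - P.residue v) Λ) ↪ PolySite (P.hull r (shiftSet v Λ)) :=
  (PolySite.shiftEmb v (P.hull (r - P.residue v) Λ)).trans (PolySite.incl (P.hull_shiftSet r v Λ).symm.subset)

/-- **Covariance of the sparse map**: translating the hull intertwines the sparse map of `Λ` for the class
`r - v̄` with the sparse map of `Λ + v` for the class `r`. [cite: BratteliKishimotoRobinson1978, Thm. 1 (proof) and Thm. 2] -/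
theorem fermionEmbed_hullShiftEmb_sparseMap (r : Fin d → ZMod P.a) (v : Site d) (Λ : Finset (Site d))
    (Y : FermionOp (P.hull (r - P.residue v) Λ)) :
    fermionEmbed (P.hullShiftEmb r v Λ) (P.sparseMap (r - P.residue v) Λ Y) =
      P.sparseMap r (shiftSet v Λ) (fermionEmbed (P.hullShiftEmb r v Λ) Y) := by
  have hT : P.touch r (shiftSet v Λ) =
      (P.touch (r - P.residue v) Λ).map (Equiv.addRight v).toEmbedding := by
    rw [P.touch_shiftSet]; rfl
  unfold sparseMap
  rw [Finset.noncommProd_congr hT (fun _ _ => rfl)]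
  refine apply_noncommProd_apply_map (fun X => fermionEmbed (P.hullShiftEmb r v Λ) X) _ _ _ _ _ _
    (fun x hx X => ?_) Y
  -- the factor at `x` is carried to the factor at `x + v`
  have hxW : shiftSet x P.Λ₀ ⊆ P.hull (r - P.residue v) Λ := P.shiftSet_subset_hull hx
  have hx' : x + v ∈ P.touch r (shiftSet v Λ) := by
    rw [P.mem_touch_shiftSet, add_sub_cancel_right]; exact hx
  have hxW' : shiftSet (x + v) P.Λ₀ ⊆ P.hull r (shiftSet v Λ) := P.shiftSet_subset_hull hx'
  have hφ : (P.transEmb x hxW).trans (P.hullShiftEmb r v Λ) = P.transEmb (x + v) hxW' :=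
    DFunLike.ext _ _ fun y => Subtype.ext (by
      simp only [Function.Embedding.trans_apply, hullShiftEmb, transEmb, PolySite.coe_incl,
        PolySite.coe_shiftEmb, ofLex_toLex, add_assoc])
  change fermionEmbed (P.hullShiftEmb r v Λ) (P.localMap _ x X) =
    P.localMap _ (x + v) (fermionEmbed (P.hullShiftEmb r v Λ) X)
  rw [P.localMap_of_subset hxW, P.localMap_of_subset hxW', fermionEmbed_krausMap, hφ]

/-- **Translation covariance of the sparse perturbation.** For a translation-invariant even state `ω`:
`(sparseState r ω) ∘ τ_v = sparseState (r - v̄) ω` — translating by `v` the state perturbed along the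
sublattice `x ≡ r` gives the state perturbed along `x ≡ r - v̄`.
[cite: BratteliKishimotoRobinson1978, Thm. 2 (translation-invariant interactions and states)] -/
theorem shift_sparseState (r : Fin d → ZMod P.a) (ω : InfVolFermionState d) (hω : ω.IsEven)
    (hωT : ω.IsTranslationInvariant) (v : Site d) :
    (P.sparseState r ω hω).shift v = P.sparseState (r - P.residue v) ω hω := by
  refine InfVolFermionState.ext fun Λ => LinearMap.ext fun B => ?_
  rw [InfVolFermionState.shift_expect, sparseState_expect, sparseState_expect]
  -- move the right-hand side into the hull of `Λ + v` using the invariance of `ω`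
  set W := P.hull (r - P.residue v) Λ with hW
  have hWW : shiftSet v W ⊆ P.hull r (shiftSet v Λ) := (P.hull_shiftSet r v Λ).symm.subset
  conv_rhs => rw [← hωT v, InfVolFermionState.shift_expect, ← ω.compatible hWW, fermionEmbed_fermionEmbed]
  change _ = ω.expect _ (fermionEmbed (P.hullShiftEmb r v Λ) (P.sparseMap (r - P.residue v) Λ _))
  rw [P.fermionEmbed_hullShiftEmb_sparseMap, fermionEmbed_fermionEmbed, fermionEmbed_fermionEmbed]
  congr 2

/-! ### §3. The cell average and its translation invariance -/

variable [NeZero P.a]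

/-- **The cell-averaged perturbed state**: the uniform average, over all residue classes `r ∈ (ℤ/aℤ)^d`, of
the sparse perturbations `sparseState r ω` — the state `ω` perturbed at density `a^{-d}` by the local Kraus
map, made translation invariant by averaging over the `a^d` sublattices (the comparison state of the
variational argument). [cite: BratteliKishimotoRobinson1978, Thm. 2 (proof); Ruelle1969GroundState Thm. 2] -/
def cellState (ω : InfVolFermionState d) (hω : ω.IsEven) : InfVolFermionState d :=
  InfVolFermionState.avgState fun r : Fin d → ZMod P.a => P.sparseState r ω hω

/-- `cellState` unfolded. [cite: BratteliKishimotoRobinson1978, Thm. 2 (proof)] -/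
theorem cellState_expect (ω : InfVolFermionState d) (hω : ω.IsEven) (Λ : Finset (Site d)) (A : FermionOp Λ) :
    (P.cellState ω hω).expect Λ A =
      ((Fintype.card (Fin d → ZMod P.a) : ℂ)⁻¹) * ∑ r : Fin d → ZMod P.a, (P.sparseState r ω hω).expect Λ A :=
  InfVolFermionState.avgState_expect _ Λ A

/-- **The cell average is translation invariant** (for a translation-invariant even `ω`): translating by
`v` permutes the residue classes `r ↦ r - v̄`. [cite: BratteliKishimotoRobinson1978, Thm. 2 (proof: invariant comparison states)] -/
theorem cellState_isTranslationInvariant (ω : InfVolFermionState d) (hω : ω.IsEven)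
    (hωT : ω.IsTranslationInvariant) : (P.cellState ω hω).IsTranslationInvariant := by
  intro v
  unfold cellState
  rw [InfVolFermionState.shift_avgState]
  have h : (fun r : Fin d → ZMod P.a => (P.sparseState r ω hω).shift v) =
      (fun r : Fin d → ZMod P.a => P.sparseState r ω hω) ∘ (Equiv.subRight (P.residue v)) := by
    funext r
    rw [P.shift_sparseState r ω hω hωT v]
    rfl
  rw [h, InfVolFermionState.avgState_comp_equiv]

/-- The mean energy of the cell average is the average of the mean energies of the sparse perturbations.
[cite: BratteliKishimotoRobinson1978, §3 (the mean energy functional is affine)] -/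
theorem meanEnergy_cellState (Ψ : FermionInteraction d) (R : ℝ) (ω : InfVolFermionState d) (hω : ω.IsEven) :
    (P.cellState ω hω).meanEnergy Ψ R =
      (Fintype.card (Fin d → ZMod P.a) : ℝ)⁻¹ * ∑ r : Fin d → ZMod P.a, (P.sparseState r ω hω).meanEnergy Ψ R :=
  InfVolFermionState.meanEnergy_avgState Ψ R _

end KrausPattern

end Literature.MathematicalPhysics.QuantumLattice

end
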